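import Literature.Computability.Cryptography.RegevReductionStepSplit
import Literature.Algebra.EuclideanLattices.RegevDigitRecursion
import HarnessLib

/-!
# Regev 2009, Lemma 3.4 in machine form = Lemma 3.5 (the classical digit loop) + Lemmas 3.7/3.11 (the
# `CVP^{(p)}` family around the `LWE` oracle): the residual A_cvp SPLIT along Regev's own lemma
# boundary, with the assembly PROVED

Topic `Computability/Cryptography` (family `pqc`), sequel of `RegevReductionStepSplit.lean` (the named
facts `regev2009_lemma_3_4_cvpFamily q α` = residual A_cvp and `regev2009_lemma_3_14_stepFamily q α` =
residual A_q14, the TWO remaining named residuals of the tree's formalisation of Regev's Theorem 1.1: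
`regev_lwe_to_sivp_quantum_holds_of_cvp_of_step`, `regev_lwe_to_gapSVP_quantum_holds_of_cvp_of_step`)
and of `Algebra/EuclideanLattices/RegevDigitRecursion.lean` (the mathematics of ONE step of the digit
recursion of Lemma 3.5: `Regev2009.norm_inv_smul_sub_sub_eq`, `Regev2009.dvd_repr_sub_val`).
O. Regev, *On lattices, learning with errors, random linear codes, and cryptography*, J. ACM 56 (2009),
art. 34 (author's version arXiv:2401.03703, whose page numbers are quoted), §3.2.1 "From samples to
`CVP`" (pp. 15–16): "For an `n`-dimensional lattice `L`, some `0 < d < λ₁(L)/2`, and an integer `p ≥ 2`,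
we say that an algorithm solves `CVP^{(p)}_{L,d}` if, given any point `x ∈ ℝⁿ` within distance `d` of
`L`, it outputs `L⁻¹κ_L(x) mod p ∈ ℤ_pⁿ`, the coefficient vector of the closest vector to `x` reduced
modulo `p`." **Lemma 3.5** (Finding coefficients modulo `p` is sufficient): "There exists an efficient
algorithm that given a lattice `L`, a number `d < λ₁(L)/2` and an integer `p ≥ 2`, solves `CVP_{L,d}`
given access to an oracle for `CVP^{(p)}_{L,d}`." (proof: "`x₁ = x`, … `a_i = L⁻¹κ_L(x_i)` …
`x_{i+1} = (x_i − L(a_i mod p))/p` … the distance of `x_{i+1}` from `L` is at most `d/pⁱ` … After `n`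
steps … Babai's nearest plane algorithm … we can now recover `a_n = p a_{n+1} + (a_n mod p)` …"). Then
(p. 16): "As we noted in the proof of Lemma 3.3, for our choice of `r`, `αp/(√2 r) ≤ λ₁(L*)/2`. Hence, in
order to prove Lemma 3.4, it suffices to present an efficient algorithm for `CVP^{(p)}_{L*,αp/(√2r)}`.
We do this by combining two lemmas. The first, Lemma 3.7, shows an algorithm `W'` that, given samples
from `A_{s,Ψ_β}` for some (unknown) `β ≤ α`, outputs `s` with probability exponentially close to `1` by
using `W` as an oracle. Its proof is based on Lemma 3.6. The second, Lemma 3.11, is the main lemma of this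
subsection, and shows how to use `W'` and the given samples from `D_{L,r}` in order to solve
`CVP^{(p)}_{L*,αp/(√2r)}`."

THIS FILE types the two halves of that sentence as machine-level named facts over the tree's uniform
quantum circuit families and PROVES that together they give A_cvp:

* `regev2009_lemma_3_11_cvpqFamily q α` (NAMED FACT A_cvpq = Lemma 3.11 run with the `W'` of Lemma 3.7
  — itself built on the verifier of Lemma 3.6 — with the `LWE` solver `W` of Theorem 3.1 SUBSTITUTED,
  Bennett–Bernstein–Brassard–Vazirani 1997, Thm. 4.14; in machine form): under the hypotheses of
  Theorem 3.1 exactly as typed in A_cvp, a uniform family `T` (the `CVP^{(q)}` solver), a batch-size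
  polynomial `p_N` (Regev's "polynomial number of samples from `D_{L,r}`") and a negligible `ν` such
  that, eventually in `n`, for every nonsingular `I` of dimension `n`, every rational
  `ρ > √2 q(n) η_{ε(n)}(L(I))`, every level `k` and every RATIONAL dual point
  `x = Σ_j t_j b^∨_j` (`Regev2009.DigitOracle.point`, `t : Fin n → ℚ` its coordinates in the dual basis
  `B^∨` of the instance) within `αq/(√2ρ)` of `L(I)*` (`DigitOracle.Admissible`), the probability that
  `T`, run on the query string `DigitOracle.query I ρ k (encBatch b) t` carrying a batch
  `b ∼ D_{L(I),ρ}^{p_N(n)}`, does NOT write the digit table `DigitOracle.answerTable (q n) I t` — the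
  `n` residues `((B^∨)⁻¹ κ_{L*}(x))_j mod q(n)`, `⌈log₂(q+1)⌉` bits each — on its first wires is at most
  `ν(n)` ON AVERAGE OVER THE BATCH (`DigitOracle.failProb`; as in A_cvp, Regev's note after Lemma 3.3).
* `regev2009_lemma_3_5_liftFamily q` (NAMED FACT A_lift = Lemma 3.5 in machine form, for the dual lattice
  and in the query/answer formats of A_cvp and A_cvpq; it does not mention `α`, `W` or the Gaussian
  batch): if `q` is polynomial-time computable and `q(n) ≥ 2` eventually, then for EVERY uniform family
  `T` (a candidate `CVP^{(q)}` solver — no promise on `T`) there are a uniform family `R` (Regev's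
  algorithm of Lemma 3.5 with `T` substituted for its `CVP^{(q)}` oracle: parse the query datum `c` of
  the `CVP` format, run the digit loop `x_{i+1} = (x_i − B^∨(a_i mod q))/q` for `p_R(n)` rounds querying
  `T` at the points `x_i` and forwarding the batch code `y` verbatim, finish with LLL and Babai's
  nearest plane on the reversed dual basis, back-substitute `a_i = q a_{i+1} + (a_i mod q)`, print the
  answer table of A_cvp), a polynomial `p_R` (the number of rounds), a constant `C` and a negligible `ν`
  such that, eventually in `n`, for every nonsingular `I` of dimension `n`, all `ρ, k, y`, every
  `d < λ₁(L(I)*)/2` and every `CVP`-admissible datum `c` at distance `d` (`CVPOracle.Admissible`), the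
  failure probability of `R` on `CVPOracle.query I ρ k y c` is at most
  `C · Σ_{i < p_R(n)} failProb_T(x_i) + ν(n)`, the sum of the failure probabilities of `T` on the queries
  of the TRUE iterates `x_i = DigitOracle.iter (q n) I (DigitOracle.ratOf c) i` of Regev's recursion
  (the union bound along the run in which every call is answered correctly: BBBV 1997, Thm. 3.3 /
  the law of total probability for the classically controlled loop).
* `regev2009_lemma_3_4_cvpFamily_of_cvpq_of_lift : A_cvpq → A_lift → A_cvp` — PROVED: take `T, p_N, ν_T`
  of A_cvpq and the `R, p_R, C, ν_R` of A_lift for this `T` (`q` is polynomial-time by `IsPolyTimeParams`,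
  and `q(n) ≥ 2` eventually since `2 ≤ 2√n < αq < q`); Regev's check `αq/(√2ρ) < λ₁(L*)/2`
  (`Regev2009.decodingDist_lt_half_minNorm_dual` of `RegevReductionStepSplit.lean`, Claim 2.13); the
  invariant of the recursion — every true iterate `x_i` is again an admissible point, at distance
  `≤ d/qⁱ ≤ d` of `L(I)*` (`DigitOracle.iter_admissible`, from `Regev2009.norm_inv_smul_sub_sub_eq` and
  `Regev2009.dvd_repr_sub_val`: "the closest lattice point to `x_{i+1}` is `L(a_i − (a_i mod p))/p`") —
  so that A_cvpq bounds every term; exchanging the average over the batch with the finite sum over the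
  rounds (`Summable.tsum_finsetSum` in `ℝ≥0∞`) gives `E_b[fail_R(b,c)] ≤ p_R(n)·|C|·|ν_T(n)| + |ν_R(n)|`,
  negligible (`IsNegligible.polynomial_mul`).
* Consequences (by `RegevReductionStepSplit.lean` and the proved chain below it):
  `regev2009_lemma_3_3_stepExact_of_cvpq_of_lift_of_step` (A_exact),
  `regev2009_lemma_3_3_stepMachine_of_cvpq_of_lift_of_step` (A_step),
  `regev_lwe_to_sivp_quantum_holds_of_cvpq_of_lift_of_step` (`pqc.S19` as filed) and
  `regev_lwe_to_gapSVP_quantum_holds_of_cvpq_of_lift_of_step` (the `GapSVP` form) from A_cvpq, A_lift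
  and A_q14 alone.

New vocabulary (`namespace Regev2009.DigitOracle`, the interface of the `CVP^{(q)}` subroutine; bodies,
no named fact): `point I t = Σ_j t_j b^∨_j` (rational dual coordinates `t`), `digits q I t`
(`= ((B^∨)⁻¹κ_{L*}(point I t))_j mod q` as naturals `< q`, through `CVPOracle.coords`),
`answerTable q I t` (their table, `Nat.size q` bits per entry, in the format `CVPOracle.table`),
`query I ρ k y t = ⟨⟨x, ⟨1^{k+1}, y⟩⟩, code t⟩` (the stage input of the sampler paired with the headed
list code `CodeFP.listE encodeRat` of the coordinates), `failProb`, `Admissible I d t`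
(`dist(point I t, L(I)*) ≤ d`), `ratOf c` (the rational coordinates `s_j/2^{ℓ_R}` of a `CVP` datum;
`point_ratOf`), Regev's recursion `next q I t = (t − digits)/q`, `iter q I t i = next^[i] t`, with
`point_next` (`x_{i+1} = q⁻¹(x_i − B^∨ r)`), `exists_near_iter` (distance `≤ d/qⁱ`), `iter_admissible`,
and `query_injOn` (the datum is determined by its query string, so the answer is a function of the query).

RESIDUAL HYPOTHESES of Regev's Theorem 1.1 after this file: A_cvpq (classical around the `LWE` oracle:
Lemma 3.11's sample manufacture `(L⁻¹v mod p, ⟨x,v⟩/p + e)` from the batch, its statistical-distance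
analysis (Claims 3.8, 3.9, Corollary 3.10), Lemma 3.7's noise schedule and Lemma 3.6's verifier, with
`W` substituted — BBBV Thm. 4.14), A_lift (classical around `T`: the digit loop, LLL, Babai, exact rational
arithmetic, the union bound for the substituted `T` — BBBV Thms. 3.3/4.14 in the tree's
`CWrap*.lean`/`ChainCompose*.lean` idiom) and A_q14 (quantum, unchanged). VALUE = three typed residuals
replacing two, the new cut running along the boundary between Regev's Lemma 3.5 and Lemmas 3.7/3.11, and
a machine-checked assembly including the correctness invariant of Lemma 3.5's recursion — NOT a proof of
any of the three parts, and not progress on any open problem (Regev's theorem is KNOWN; the summit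
statements `LWEInBQP`/its negation are untouched).

## Faithfulness notes

* Lemma 3.5 is stated by Regev for an arbitrary lattice and an exact oracle; A_lift is its instance for
  the dual lattice `L(I)*` of the input instance in the bases `B`, `B^∨` fixed by the tree
  (`Peikert2009.dualVec`, `Peikert2009.dualZBasis`), with an IMPERFECT oracle `T` and the failure
  accounting made explicit (the printed proof needs every oracle answer along the run to be correct;
  the bound charges `T` only on the true iterates, which is what the hybrid argument gives). The number
  of rounds `p_R(n)` may depend on `n` only (not on the size of the entries of `I`), as the uniformity of
  `ν(n)` in A_cvp demands; Regev's `n` rounds followed by Babai on an LLL-reduced basis (tree: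
  `Regev2009.norm_div_pow_lt_gramSchmidt_dual_rev`, `Algebra/EuclideanLattices/RegevDigitRounds.lean`:
  `2n` rounds on the reversed dual of an LLL-reduced basis, any `q ≥ 2`) meet this.
* A_cvpq asks `T` to answer at every RATIONAL point of the dual span given by dual coordinates (Regev:
  every real point within `αp/(√2r)` of `L*`); all the iterates of Lemma 3.5 started at the dyadic
  points of A_cvp are such points (`iter`, `ratOf`).
* The error of `R` on the batch average is `Σ_i E_b[fail_T(x_i, b)]`, each term bounded by A_cvpq
  uniformly in the point: this is Regev's note after Lemma 3.3 (correctness for all but a negligible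
  fraction of the sample tuples, uniformly in the point) applied round by round.
* Nothing here restates `pqc.S19` or alters A_cvp / A_q14 / A_exact; the junk conventions (singular
  instances, points far from the lattice) are those of A_cvp: `point I t = 0` and `coords = 0` off the
  promise, and the named facts only constrain admissible data.

## Satisfiability audit (the named facts are not vacuously false)

* A_cvpq: the answer `answerTable (q n) I t` has `n · Nat.size (q n)` bits, polynomial in the query
  length (the query contains the code of `I`, of length `≥ n`, and `q` is polynomial-time computable
  from `1ⁿ`, so `Nat.size (q n) ≤ poly(n)`), hence printable by a polynomial-size family on its first
  wires; the datum `t` is determined by the query string (`DigitOracle.query_injOn`), so the required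
  answer is a function of the query; the failure bound is uniform in `t` as Regev's analysis is (the
  statistical distance of the manufactured samples from `A_{s,Ψ_β}` depends on `r > √2 p η_ε(L)` and
  `α` only: Claims 3.8, 3.9 and Corollary 3.10). The length of `T`'s query varies with `t`; a caller
  handles this as the tree's classical wraps do (`QuantumComplexity/CWrapFamily.lean`: one verbatim
  copy of the callee per admissible length, on its own block of wires).
* A_lift: `R`'s answer is the table of A_cvp, which fits on the wires by the width clause `b_c ≤ ℓ_R`
  of `CVPOracle.Admissible` (inherited); `R` makes `p_R(n)` calls whose query strings have length
  polynomial in `R`'s input length (the coordinates of `x_i` have denominators `2^{ℓ_R} q(n)ⁱ` and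
  bounded numerators); with every call answered correctly `R`'s output is correct by Lemma 3.5's proof
  (`iter_admissible`, `exists_near_iter`, `Regev2009.norm_div_pow_lt_gramSchmidt_dual_rev`), so
  `fail_R ≤ Σ_i fail_T(x_i)` (`C = 1`, `ν = 0` already satisfy it for an exactly compiled classical
  part; `C`, `ν` leave room for gate-set approximation).

## References

* O. Regev, *On lattices, learning with errors, random linear codes, and cryptography*, J. ACM 56 (2009),
  art. 34; author's version arXiv:2401.03703: §3.2.1 (pp. 15–16: definition of `CVP^{(p)}`, Lemma 3.4,
  Lemma 3.5 and its proof, the reduction of Lemma 3.4 to Lemmas 3.7 and 3.11), Lemma 3.6, Lemma 3.7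
  (p. 16), Lemma 3.11 (p. 18), note after Lemma 3.3 (p. 15), Claim 2.13 (p. 14). [Regev2009] [RegevLWE2009]
* C. H. Bennett, E. Bernstein, G. Brassard, U. Vazirani, *Strengths and weaknesses of quantum computing*,
  SIAM J. Comput. 26 (1997), Thm. 3.3 (hybrid argument), Thm. 4.14 (tidy subroutines).
  [BennettBernsteinBrassardVazirani1997]
* L. Babai, *On Lovász' lattice reduction and the nearest lattice point problem*, Combinatorica 6 (1986).
  [Babai1986]
* S. Arora, B. Barak, *Computational Complexity: A Modern Approach*, CUP 2009, §0.1 (codes of pairs and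
  lists). [AroraBarak2009]
-/

noncomputable section

namespace Literature.Computability.Cryptography

open Filter _root_.Computability Literature.Computability.Complexity
  Literature.Algebra.EuclideanLattices Literature.Computability.QuantumComplexity
  Literature.Computability.Cryptography.LWE
open scoped ENNReal

namespace Regev2009

namespace DigitOracle

open Brick Literature.Computability.Cryptography.Peikert2009
open scoped InnerProductSpace

/-! ### The query point, the digits and the answer of the `CVP^{(q)}` subroutine -/

/-- **The query point** of rational dual coordinates `t`: `Σ_j t_j b^∨_j`, a point of the rational span
of `L(B)*` (and `0` on a singular instance, where there is no dual basis).
[cite: Regev2009, §3.2.1 (definition of CVP^{(p)}: "given any point x ∈ ℝⁿ within distance d of L")] -/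
def point (I : LatticeInstance) (t : Fin I.n → ℚ) : EuclideanSpace ℝ (Fin I.n) :=
  if h : I.IsNonsingular then
    haveI := I.isZLattice_of_isNonsingular h
    ∑ j, ((t j : ℚ) : ℝ) • dualVec I j
  else 0

/-- The query point on a nonsingular instance. [folklore] -/
theorem point_eq (I : LatticeInstance) [IsZLattice ℝ I.lattice] (t : Fin I.n → ℚ) :
    point I t = ∑ j, ((t j : ℚ) : ℝ) • dualVec I j := by
  rw [point, dif_pos (isNonsingular_of_isZLattice I)]

/-- **The digits**: the dual coordinates of the closest point of `L(B)*` to the query point, reduced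
modulo `q`, as naturals `< q` — Regev's `L⁻¹κ_L(x) mod p ∈ ℤ_pⁿ` (through `CVPOracle.coords`, hence `0` off
the promise). [cite: Regev2009, §3.2.1 (definition of CVP^{(p)}_{L,d})] -/
def digits (q : ℕ) (I : LatticeInstance) (t : Fin I.n → ℚ) : Fin I.n → ℕ :=
  fun j => ((CVPOracle.coords I (point I t) j : ZMod q)).val

/-- The digits are residues modulo `q`. [folklore] -/
theorem digits_lt (q : ℕ) [NeZero q] (I : LatticeInstance) (t : Fin I.n → ℚ) (j : Fin I.n) :
    digits q I t j < q := ZMod.val_lt _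

/-- **The answer**: the table of the digits, `Nat.size q` bits per entry (`n · Nat.size q` bits).
[cite: Regev2009, §3.2.1 ("outputs L⁻¹κ_L(x) mod p ∈ ℤ_pⁿ")] -/
def answerTable (q : ℕ) (I : LatticeInstance) (t : Fin I.n → ℚ) : List Bool :=
  CVPOracle.table (Nat.size q) (digits q I t)

/-- The answer table has `n · Nat.size q` bits. [folklore] -/
theorem length_answerTable (q : ℕ) (I : LatticeInstance) (t : Fin I.n → ℚ) :
    (answerTable q I t).length = I.n * Nat.size q := by
  unfold answerTable CVPOracle.table
  rw [List.length_flatten, List.map_ofFn]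
  simp [Function.comp_def]

/-- **The query string**: the sampler's stage input `⟨x, ⟨1^{k+1}, y⟩⟩` (instance and radius, level,
batch code) paired with the headed list code of the rational coordinates `t`.
[cite: Regev2009, Lemma 3.5 (proof: "this sequence can be computed by using the oracle")] [cite: AroraBarak2009, §0.1] -/
def query (I : LatticeInstance) (r : ℚ) (k : ℕ) (y : List Bool) (t : Fin I.n → ℚ) : List Bool :=
  boolPair (stageInput (GapSVPInstance.encode (I, r)) (k + 1) y) (CodeFP.listE encodeRat (List.ofFn t))

/-- **The coordinates are determined by the query string** (so the required answer is a function of the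
query). [cite: AroraBarak2009, §0.1 (unique parsing of pairs and lists)] -/
theorem query_injOn (I : LatticeInstance) (r : ℚ) (k : ℕ) (y : List Bool) {t t' : Fin I.n → ℚ}
    (heq : query I r k y t = query I r k y t') : t = t' := by
  have h := congrArg sndF heq
  simp only [query, sndF_boolPair] at h
  exact List.ofFn_injective (CodeFP.listE_injective encodeRat_injective h)

/-- The classical prefix of the query string. [folklore] -/
@[simp] theorem fstF_query (I : LatticeInstance) (r : ℚ) (k : ℕ) (y : List Bool) (t : Fin I.n → ℚ) :
    fstF (query I r k y t) = stageInput (GapSVPInstance.encode (I, r)) (k + 1) y := fstF_boolPair _ _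

/-- The coordinate code is the second field of the query string. [folklore] -/
@[simp] theorem sndF_query (I : LatticeInstance) (r : ℚ) (k : ℕ) (y : List Bool) (t : Fin I.n → ℚ) :
    sndF (query I r k y t) = CodeFP.listE encodeRat (List.ofFn t) := sndF_boolPair _ _

/-- **The failure probability of a family `T` on the query of `t`** at `(I, ρ, k, y)`: the probability
that the measured wires of `T` run on `query I ρ k y t` do NOT start with `answerTable q I t`.
[cite: Regev2009, §3.2.1 ("solves CVP^{(p)}_{L,d}")] -/
def failProb (T : UniformQCircuitFamily) (q : ℕ) (I : LatticeInstance) (ρ : ℚ) (k : ℕ) (y : List Bool)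
    (t : Fin I.n → ℚ) : ℝ :=
  1 - T.kernelProb (query I ρ k y t) {s | answerTable q I t <+: s}

/-- `0 ≤ failProb`. [folklore] -/
theorem failProb_nonneg (T : UniformQCircuitFamily) (q : ℕ) (I : LatticeInstance) (ρ : ℚ) (k : ℕ)
    (y : List Bool) (t : Fin I.n → ℚ) : 0 ≤ failProb T q I ρ k y t :=
  sub_nonneg.2 (T.kernelProb_le_one _ _)

/-- `failProb ≤ 1`. [folklore] -/
theorem failProb_le_one (T : UniformQCircuitFamily) (q : ℕ) (I : LatticeInstance) (ρ : ℚ) (k : ℕ)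
    (y : List Bool) (t : Fin I.n → ℚ) : failProb T q I ρ k y t ≤ 1 := by
  have h : 0 ≤ T.kernelProb (query I ρ k y t) {s | answerTable q I t <+: s} := by
    rw [UniformQCircuitFamily.kernelProb_eq]
    exact ENNReal.toReal_nonneg
  unfold failProb
  linarith

/-- **Admissible coordinates at decoding distance `d`**: the query point lies within `d` of the dual
lattice `L(I)*` — the promise of `CVP^{(q)}_{L*,d}`. [cite: Regev2009, §3.2.1 ("given any point x ∈ ℝⁿ within distance d of L")] -/
def Admissible (I : LatticeInstance) (d : ℝ) (t : Fin I.n → ℚ) : Prop :=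
  ∃ v ∈ dualLattice I.lattice, ‖point I t - v‖ ≤ d

/-- Admissibility is monotone in the distance. [folklore] -/
theorem Admissible.mono {I : LatticeInstance} {d d' : ℝ} {t : Fin I.n → ℚ} (h : Admissible I d t)
    (hdd' : d ≤ d') : Admissible I d' t := by
  obtain ⟨v, hv, hle⟩ := h
  exact ⟨v, hv, hle.trans hdd'⟩

/-- An admissible distance is nonnegative. [folklore] -/
theorem Admissible.nonneg {I : LatticeInstance} {d : ℝ} {t : Fin I.n → ℚ} (h : Admissible I d t) : 0 ≤ d := by
  obtain ⟨v, -, hle⟩ := h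
  exact (norm_nonneg _).trans hle

/-! ### From the dyadic data of the `CVP` oracle of Lemma 3.14 -/

/-- **The rational coordinates of a `CVP` query datum** `(s, ℓ_R, b_c)`: `t_j = s_j / 2^{ℓ_R}`.
[cite: Regev2009, Lemma 3.14 (proof: the points of L*/R, R = 2^{ℓ_R})] -/
def ratOf {n : ℕ} (c : CVPOracle.QData n) : Fin n → ℚ := fun j => (c.1 j : ℚ) / 2 ^ c.2.1

/-- The point of the rational coordinates of a `CVP` datum is its query point. [folklore] -/
theorem point_ratOf (I : LatticeInstance) (c : CVPOracle.QData I.n) : point I (ratOf c) = CVPOracle.point I c := by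
  by_cases hI : I.IsNonsingular
  · haveI := I.isZLattice_of_isNonsingular hI
    rw [point_eq, CVPOracle.point_eq]
    refine Finset.sum_congr rfl fun j _ => ?_
    rw [ratOf, Rat.cast_div, Rat.cast_natCast, Rat.cast_pow, Rat.cast_ofNat]
  · rw [point, CVPOracle.point, dif_neg hI, dif_neg hI]

/-- **`CVP`-admissible data have admissible rational coordinates.** [folklore] -/
theorem admissible_ratOf (I : LatticeInstance) {d : ℝ} {c : CVPOracle.QData I.n} (hc : CVPOracle.Admissible I d c) :
    Admissible I d (ratOf c) := by
  obtain ⟨-, -, v, hv, hle⟩ := hc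
  exact ⟨v, hv, by rwa [point_ratOf]⟩

/-! ### Regev's recursion (Lemma 3.5) on the coordinates -/

/-- **One step of Regev's recursion** in dual coordinates: `t ↦ (t − (a mod q))/q`, i.e.
`x_{i+1} = (x_i − B^∨(a_i mod q))/q`. [cite: Regev2009, Lemma 3.5 (proof: "x_{i+1} = (x_i − L(a_i mod p))/p")] -/
def next (q : ℕ) (I : LatticeInstance) (t : Fin I.n → ℚ) : Fin I.n → ℚ :=
  fun j => (t j - digits q I t j) / q

/-- **The true iterates** `x_1 = x, x_2, x_3, …` of Regev's recursion (indexed from `0`).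
[cite: Regev2009, Lemma 3.5 (proof: "We define a sequence of points x₁ = x, x₂, x₃, …")] -/
def iter (q : ℕ) (I : LatticeInstance) (t : Fin I.n → ℚ) (i : ℕ) : Fin I.n → ℚ := (next q I)^[i] t

/-- `iter 0 = id`. [folklore] -/
@[simp] theorem iter_zero (q : ℕ) (I : LatticeInstance) (t : Fin I.n → ℚ) : iter q I t 0 = t := rfl

/-- `iter (i+1) = next ∘ iter i`. [folklore] -/
theorem iter_succ (q : ℕ) (I : LatticeInstance) (t : Fin I.n → ℚ) (i : ℕ) :
    iter q I t (i + 1) = next q I (iter q I t i) :=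
  Function.iterate_succ_apply' _ _ _

/-- The dual lattice point with integer coordinates `r`: `B^∨ r = Σ_j r_j b^∨_j`. [folklore] -/
theorem coe_dualZBasis_equivFun_symm (I : LatticeInstance) [IsZLattice ℝ I.lattice] (r : Fin I.n → ℤ) :
    (((dualZBasis I).equivFun.symm r : dualLattice I.lattice) : EuclideanSpace ℝ (Fin I.n)) =
      ∑ j, (r j : ℝ) • dualVec I j := by
  rw [CVPOracle.coe_dualZBasis_repr_symm I ((dualZBasis I).equivFun.symm r)]
  refine Finset.sum_congr rfl fun j _ => ?_
  rw [← Module.Basis.equivFun_apply, LinearEquiv.apply_symm_apply]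

/-- **The next point is `q⁻¹(x − B^∨ r)`**, `r = a mod q` the digit vector. [cite: Regev2009, Lemma 3.5 (proof)] -/
theorem point_next (q : ℕ) [NeZero q] (I : LatticeInstance) [IsZLattice ℝ I.lattice] (t : Fin I.n → ℚ) :
    point I (next q I t) =
      (q : ℝ)⁻¹ • (point I t - ((dualZBasis I).equivFun.symm (fun j => (digits q I t j : ℤ)) :
        EuclideanSpace ℝ (Fin I.n))) := by
  rw [point_eq, point_eq, coe_dualZBasis_equivFun_symm, ← Finset.sum_sub_distrib, Finset.smul_sum]
  refine Finset.sum_congr rfl fun j _ => ?_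
  rw [← sub_smul, smul_smul, next, Rat.cast_div, Rat.cast_sub, Rat.cast_natCast, Rat.cast_natCast,
    Int.cast_natCast, div_eq_inv_mul]

/-- **The distance shrinks by `q`** (Regev: "the closest lattice point to `x_{i+1}` is
`L(a_i − (a_i mod p))/p` … the distance of `x_{i+1}` from `L` is at most `d/pⁱ`"): if the query point of
`t` is within `d < λ₁(L*)/2` of `L(I)*` then the query point of `next q I t` is within `d/q` of `L(I)*`.
[cite: Regev2009, Lemma 3.5 (proof)] -/
theorem exists_near_next (q : ℕ) [NeZero q] (I : LatticeInstance) [IsZLattice ℝ I.lattice] {t : Fin I.n → ℚ}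
    {d : ℝ} (hd : d < minNorm (dualLattice I.lattice) / 2) (ht : Admissible I d t) :
    ∃ v ∈ dualLattice I.lattice, ‖point I (next q I t) - v‖ ≤ d / q := by
  obtain ⟨v, hv, hdist⟩ := ht
  set b := dualZBasis I
  set κ : dualLattice I.lattice := ⟨v, hv⟩
  have hlt : ‖point I t - (κ : EuclideanSpace ℝ (Fin I.n))‖ < minNorm (dualLattice I.lattice) / 2 :=
    hdist.trans_lt hd
  have hco : CVPOracle.coords I (point I t) = fun j => b.repr κ j := CVPOracle.coords_eq_repr I κ hlt
  set r : Fin I.n → ℤ := fun j => (digits q I t j : ℤ)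
  have hr : ∀ j, (q : ℤ) ∣ b.repr κ j - r j := fun j => by
    have h := Literature.Algebra.EuclideanLattices.Regev2009.dvd_repr_sub_val b q κ j
    have hrj : r j = (((b.repr κ j : ZMod q)).val : ℤ) := by
      simp only [r, digits, hco]
    rwa [hrj]
  set κ₁ : dualLattice I.lattice := b.equivFun.symm fun j => (b.repr κ j - r j) / q
  refine ⟨κ₁, κ₁.2, ?_⟩
  rw [point_next q I t,
    Literature.Algebra.EuclideanLattices.Regev2009.norm_inv_smul_sub_sub_eq b q (point I t) κ r hr]
  exact div_le_div_of_nonneg_right hdist (Nat.cast_nonneg q)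

/-- **Every true iterate is admissible, at distance `≤ d/qⁱ`** (the invariant of Lemma 3.5's recursion:
`κ_{L*}(x_i)` stays the unique close dual vector, so the `CVP^{(q)}` oracle may be called on every `x_i`).
[cite: Regev2009, Lemma 3.5 (proof: "the distance of x_{i+1} from L is at most d/pⁱ")] -/
theorem exists_near_iter (q : ℕ) [NeZero q] (I : LatticeInstance) (hI : I.IsNonsingular) {t : Fin I.n → ℚ}
    {d : ℝ} (hd : d < minNorm (dualLattice I.lattice) / 2) (ht : Admissible I d t) :
    ∀ i, Admissible I (d / q ^ i) (iter q I t i)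
  | 0 => by simpa using ht
  | i + 1 => by
    haveI := I.isZLattice_of_isNonsingular hI
    have hq1 : (1 : ℝ) ≤ q := Nat.one_le_cast.2 (Nat.pos_of_ne_zero (NeZero.ne q))
    have hi : Admissible I (d / q ^ i) (iter q I t i) := exists_near_iter q I hI hd ht i
    have hdi : d / q ^ i < minNorm (dualLattice I.lattice) / 2 :=
      (div_le_self ht.nonneg (one_le_pow₀ hq1)).trans_lt hd
    rw [iter_succ, pow_succ, ← div_div]
    exact exists_near_next q I hdi hi

/-- **Every true iterate is admissible at the original distance.** [cite: Regev2009, Lemma 3.5 (proof)] -/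
theorem iter_admissible (q : ℕ) [NeZero q] (I : LatticeInstance) (hI : I.IsNonsingular) {t : Fin I.n → ℚ}
    {d : ℝ} (hd : d < minNorm (dualLattice I.lattice) / 2) (ht : Admissible I d t) (i : ℕ) :
    Admissible I d (iter q I t i) := by
  have hq1 : (1 : ℝ) ≤ q := Nat.one_le_cast.2 (Nat.pos_of_ne_zero (NeZero.ne q))
  exact (exists_near_iter q I hI hd ht i).mono (div_le_self ht.nonneg (one_le_pow₀ hq1))

end DigitOracle

/-! ### Arithmetic of the regime -/

/-- In Regev's regime `2√n < αq`, `α < 1`, one has `q(n) ≥ 2` (indeed `> 2`) for `n ≥ 1`. [cite: Regev2009, Theorem 1.1 ("αp > 2√n")] -/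
theorem two_le_of_regime {n qv : ℕ} {av : ℝ} (hn : 0 < n) (ha1 : av < 1)
    (h : 2 * Real.sqrt n < av * qv) : 2 ≤ qv := by
  have h1 : (1 : ℝ) ≤ Real.sqrt n := by
    rw [← Real.sqrt_one]
    exact Real.sqrt_le_sqrt (by exact_mod_cast hn)
  have hq0 : (0 : ℝ) ≤ qv := Nat.cast_nonneg qv
  have h2 : av * qv ≤ qv := by nlinarith
  have h3 : (2 : ℝ) < qv := by linarith
  exact_mod_cast h3.le

end Regev2009

/-! ### The two residuals and the assembly -/

section Split

variable (q : ℕ → ℕ) [∀ n, NeZero (q n)] (α : ℕ → ℝ)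

/-- NAMED FACT (residual A_cvpq) — **Regev 2009, Lemma 3.11 with the `W'` of Lemma 3.7 (and the verifier of
Lemma 3.6), the `LWE` solver `W` substituted: the `CVP^{(p)}_{L*,αp/(√2r)}` family, in machine form.**
Lemma 3.11 (p. 18): "Let `ε(n)` be a negligible function, `p(n) ≥ 2` an integer, `α(n) ∈ (0,1)`. Assume that
we have access to an oracle `W` that for all `β ≤ α`, finds `s` given a polynomial number of samples from
`A_{s,Ψ_β}` (without knowing `β`). Then, there exists an efficient algorithm that given an `n`-dimensional
lattice `L`, a number `r > √2 p η_ε(L)`, and a polynomial number of samples from `D_{L,r}`, solves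
`CVP^{(p)}_{L*,αp/(√2r)}`"; Lemma 3.7 (p. 16) supplies that oracle `W'` from the `W` of Theorem 3.1.
Machine form, under the hypotheses of Theorem 3.1 exactly as typed in A_cvp (`W` a uniform family solving
search-`LWE_{q,Ψ̄_α}` in the worst case with `m(n)` samples, `α = a` rational and poly-time computable):
a uniform family `T`, a batch-size polynomial `p_N` and a negligible `ν` such that, eventually in `n`,
for every nonsingular `I` of dimension `n`, every rational `ρ > √2 q(n) η_{ε(n)}(L(I))`, every level `k`
and every rational dual coordinate vector `t` whose point `DigitOracle.point I t = Σ t_j b^∨_j` lies within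
`αq/(√2ρ)` of `L(I)*` (`DigitOracle.Admissible`), the probability that `T` on the query string
`DigitOracle.query I ρ k (encBatch b) t` does not write the digit table `DigitOracle.answerTable (q n) I t`
(`(B^∨)⁻¹κ_{L*}(x) mod q(n)`) on its first wires, AVERAGED over the batch `b ∼ D_{L(I),ρ}^{p_N(n)}` in
integer coordinates (`Regev2009.idealBatchZ`), is at most `ν(n)` (stated in `ℝ≥0∞`). Together with
`regev2009_lemma_3_5_liftFamily` it gives A_cvp (`regev2009_lemma_3_4_cvpFamily_of_cvpq_of_lift`).
Users take `(hT : regev2009_lemma_3_11_cvpqFamily q α)`.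
[cite: Regev2009, Lemma 3.11 (p. 18) with Lemmas 3.6, 3.7 (p. 16) and the reduction on p. 16; BennettBernsteinBrassardVazirani1997, Thm. 4.14] -/
def regev2009_lemma_3_11_cvpqFamily : Prop :=
  ∀ (m : ℕ → ℕ) (_ : IsPolyBounded m) (_ : IsPolyTimeParams q α m)
    (_ : ∀ᶠ n : ℕ in atTop, 0 < α n ∧ α n < 1 ∧ 2 * Real.sqrt n < α n * q n)
    (_ : ∃ (W : UniformQCircuitFamily) (c : ℝ), 0 < c ∧
      W.SolvesSearchLWEWorstCase q (fun n => discretizedGaussian (q n) (α n)) m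
        fun n => (2 : ℝ) ^ (-(c * n)))
    (ε : ℕ → ℝ), IsNegligible ε → (∀ n, 0 < ε n) →
    ∀ (a : ℕ → ℚ), (∀ n, α n = a n) → PolyTimeComputable unaryEncodeNat encodeRat a →
      ∃ (T : UniformQCircuitFamily) (pN : Polynomial ℕ) (ν : ℕ → ℝ),
        IsNegligible ν ∧ (∀ n, 0 < pN.eval n) ∧
        ∀ᶠ n : ℕ in atTop, ∀ (I : LatticeInstance) (ρ : ℚ), I.n = n → I.IsNonsingular →
          Real.sqrt 2 * q n * smoothingParameter I.lattice (ε n) < ρ →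
          ∀ (k : ℕ) (t : Fin I.n → ℚ),
            Regev2009.DigitOracle.Admissible I (α n * q n / (Real.sqrt 2 * ρ)) t →
            ∑' b, Regev2009.idealBatchZ I (pN.eval n) ρ b *
                ENNReal.ofReal (Regev2009.DigitOracle.failProb T (q n) I ρ k
                  (Regev2009.encBatch I.n (pN.eval n) b) t) ≤ ENNReal.ofReal (ν n)

/-- NAMED FACT (residual A_lift) — **Regev 2009, Lemma 3.5 in machine form, for the dual lattice, with the
oracle-substitution bound explicit.** "There exists an efficient algorithm that given a lattice `L`, a
number `d < λ₁(L)/2` and an integer `p ≥ 2`, solves `CVP_{L,d}` given access to an oracle for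
`CVP^{(p)}_{L,d}`" (p. 16). Machine form: if `q` is polynomial-time computable from `1ⁿ` and `q(n) ≥ 2`
eventually, then for EVERY uniform family `T` (a candidate `CVP^{(q)}` solver in the format of
`Regev2009.DigitOracle` — no promise on `T`) there are a uniform family `R` (Lemma 3.5's algorithm — parse,
`p_R(n)` rounds of `x_{i+1} = (x_i − B^∨(a_i mod q))/q` each querying `T` at `x_i` with the batch code `y`
forwarded verbatim, LLL and Babai's nearest plane on the reversed dual basis, back-substitution
`a_i = q a_{i+1} + (a_i mod q)`, the answer table of A_cvp — with `T` SUBSTITUTED as a subroutine, BBBV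
Thm. 4.14), a polynomial `p_R`, a constant `C` and a negligible `ν` such that, eventually in `n`, for every
nonsingular `I` of dimension `n`, all rational `ρ`, levels `k` and strings `y`, every `d < λ₁(L(I)*)/2`
and every `CVP` query datum `c` admissible at distance `d` (`CVPOracle.Admissible`: in range, answer width
at most the grid exponent, query point within `d` of `L(I)*`), the probability that `R` on
`CVPOracle.query I ρ k y c` does not write `CVPOracle.answerTable I c` on its first wires is at most
`C · Σ_{i < p_R(n)} DigitOracle.failProb T (q n) I ρ k y xᵢ + ν(n)`, the `xᵢ = DigitOracle.iter (q n) I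
(DigitOracle.ratOf c) i` being the TRUE iterates of the recursion started at the query point of `c` (the
union bound along the all-answers-correct run, BBBV Thm. 3.3; with every answer correct `R` is correct by
Lemma 3.5's proof: `DigitOracle.iter_admissible`, `Regev2009.norm_div_pow_lt_gramSchmidt_dual_rev`).
Users take `(hL : regev2009_lemma_3_5_liftFamily q)`.
[cite: Regev2009, Lemma 3.5 (p. 16) and its proof; Babai1986; BennettBernsteinBrassardVazirani1997, Thms. 3.3, 4.14] -/
def regev2009_lemma_3_5_liftFamily : Prop :=
  PolyTimeComputable unaryEncodeNat encodeNat q → (∀ᶠ n : ℕ in atTop, 2 ≤ q n) →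
    ∀ (T : UniformQCircuitFamily),
      ∃ (R : UniformQCircuitFamily) (pR : Polynomial ℕ) (C : ℝ) (ν : ℕ → ℝ), IsNegligible ν ∧
        ∀ᶠ n : ℕ in atTop, ∀ (I : LatticeInstance) (ρ : ℚ) (k : ℕ) (y : List Bool),
          I.n = n → I.IsNonsingular →
          ∀ d : ℝ, d < minNorm (dualLattice I.lattice) / 2 →
          ∀ c : Regev2009.CVPOracle.QData I.n, Regev2009.CVPOracle.Admissible I d c →
            Regev2009.CVPOracle.failProb R I ρ k y c ≤
              C * ∑ i ∈ Finset.range (pR.eval n),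
                  Regev2009.DigitOracle.failProb T (q n) I ρ k y
                    (Regev2009.DigitOracle.iter (q n) I (Regev2009.DigitOracle.ratOf c) i) + ν n

open Regev2009 Regev2009.DigitOracle in
/-- **A_cvp from A_cvpq and A_lift (Regev: "in order to prove Lemma 3.4, it suffices to present an efficient
algorithm for `CVP^{(p)}_{L*,αp/(√2r)}`").** Take `T, p_N, ν_T` of A_cvpq and `R, p_R, C, ν_R` of A_lift for
this `T` (`q` is polynomial-time by `IsPolyTimeParams`; `q(n) ≥ 2` eventually by `two_le_of_regime`). For
`n ≥ 1`, a nonsingular `I` of dimension `n`, `ρ > √2 q η_ε(L(I))` and an admissible datum `c`: the decoding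
distance `d = αq/(√2ρ)` is below `λ₁(L(I)*)/2` (`decodingDist_lt_half_minNorm_dual`, with `ε(n) ≤ e^{-π}`
eventually), so A_lift applies; every true iterate `xᵢ` is admissible at distance `d`
(`iter_admissible ∘ admissible_ratOf`), so A_cvpq bounds `E_b[fail_T(xᵢ, b)] ≤ ν_T(n)` for each of the
`p_R(n)` rounds; exchanging the batch average with the sum over the rounds,
`E_b[fail_R(b, c)] ≤ p_R(n)·|C|·|ν_T(n)| + |ν_R(n)| =: ν(n)`, negligible.
[cite: Regev2009, §3.2.1 (p. 16: proof of Lemma 3.4 from Lemmas 3.5, 3.7, 3.11), Lemma 3.5 (proof), Claim 2.13; BennettBernsteinBrassardVazirani1997, Thm. 3.3] -/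
theorem regev2009_lemma_3_4_cvpFamily_of_cvpq_of_lift (hT : regev2009_lemma_3_11_cvpqFamily q α)
    (hL : regev2009_lemma_3_5_liftFamily q) : regev2009_lemma_3_4_cvpFamily q α := by
  intro m hm hP hreg hW ε hε hεpos a hαa hac
  obtain ⟨T, pN, νT, hνT, hpN, hTn⟩ := hT m hm hP hreg hW ε hε hεpos a hαa hac
  obtain ⟨hqc, -, -⟩ := hP
  have hq2 : ∀ᶠ n : ℕ in atTop, 2 ≤ q n := by
    filter_upwards [hreg, eventually_gt_atTop 0] with n hregn hn
    exact two_le_of_regime hn hregn.2.1 hregn.2.2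
  obtain ⟨R, pR, C, νR, hνR, hRn⟩ := hL hqc hq2 T
  -- the negligible bound
  have hνTa : IsNegligible fun n => |νT n| :=
    Asymptotics.SuperpolynomialDecay.trans_abs_le hνT fun n => by rw [abs_abs]
  have hνRa : IsNegligible fun n => |νR n| :=
    Asymptotics.SuperpolynomialDecay.trans_abs_le hνR fun n => by rw [abs_abs]
  have hpoly : IsNegligible fun n => ((pR.eval n : ℕ) : ℝ) * (|C| * |νT n|) := by
    have h := (hνTa.const_mul |C|).polynomial_mul (pR.map (Nat.castRingHom ℝ))
    refine h.congr fun n => ?_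
    simp only [Polynomial.eval_map, Polynomial.eval₂_at_natCast]
    rfl
  have hεπ : ∀ᶠ n : ℕ in atTop, ε n ≤ Real.exp (-Real.pi) := by
    have h0 := hε 0
    simp only [pow_zero, one_mul] at h0
    exact (h0.eventually (ge_mem_nhds (Real.exp_pos _))).mono fun n hn => hn
  refine ⟨R, pN, fun n => ((pR.eval n : ℕ) : ℝ) * (|C| * |νT n|) + |νR n|, hpoly.add hνRa, hpN, ?_⟩
  filter_upwards [hTn, hRn, hreg, hεπ, eventually_gt_atTop 0] with n hTn' hRn' hregn hεn hn0 I ρ hIn hI hsm k c hc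
  obtain ⟨hα0, hα1, -⟩ := hregn
  subst hIn
  have hq0 : (0 : ℝ) < q I.n := by exact_mod_cast Nat.pos_of_ne_zero (NeZero.ne (q I.n))
  set d : ℝ := α I.n * q I.n / (Real.sqrt 2 * ρ)
  have hd : d < minNorm (dualLattice I.lattice) / 2 :=
    decodingDist_lt_half_minNorm_dual I hI hn0 (hεpos _) hεn hα0 hα1 hq0 hsm
  -- abbreviations
  set N : ℕ := pN.eval I.n
  set p : PMF (Fin N → Fin I.n → ℤ) := idealBatchZ I N ρ
  set M : ℕ := pR.eval I.n
  set f : ℕ → (Fin N → Fin I.n → ℤ) → ℝ :=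
    fun i b => DigitOracle.failProb T (q I.n) I ρ k (encBatch I.n N b) (iter (q I.n) I (ratOf c) i)
  -- every true iterate is admissible, so A_cvpq bounds every round
  have hround : ∀ i, ∑' b, p b * ENNReal.ofReal (f i b) ≤ ENNReal.ofReal |νT I.n| := fun i =>
    (hTn' I ρ rfl hI hsm k _ (iter_admissible (q I.n) I hI hd (admissible_ratOf I hc) i)).trans
      (ENNReal.ofReal_le_ofReal (le_abs_self _))
  -- the bound of A_lift, per batch, in `ℝ≥0∞`
  have hper : ∀ b, ENNReal.ofReal (CVPOracle.failProb R I ρ k (encBatch I.n N b) c) ≤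
      ∑ i ∈ Finset.range M, ENNReal.ofReal |C| * ENNReal.ofReal (f i b) + ENNReal.ofReal |νR I.n| := by
    intro b
    have h := hRn' I ρ k (encBatch I.n N b) rfl hI d hd c hc
    have hsum0 : 0 ≤ ∑ i ∈ Finset.range M, f i b :=
      Finset.sum_nonneg fun i _ => DigitOracle.failProb_nonneg _ _ _ _ _ _ _
    have h' : CVPOracle.failProb R I ρ k (encBatch I.n N b) c ≤
        |C| * ∑ i ∈ Finset.range M, f i b + |νR I.n| :=
      h.trans (add_le_add (mul_le_mul_of_nonneg_right (le_abs_self C) hsum0) (le_abs_self _))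
    refine (ENNReal.ofReal_le_ofReal h').trans ?_
    rw [ENNReal.ofReal_add (mul_nonneg (abs_nonneg C) hsum0) (abs_nonneg _),
      ENNReal.ofReal_mul (abs_nonneg C),
      ENNReal.ofReal_sum_of_nonneg fun i _ => DigitOracle.failProb_nonneg _ _ _ _ _ _ _, Finset.mul_sum]
  -- exchange the batch average with the sum over the rounds
  calc ∑' b, p b * ENNReal.ofReal (CVPOracle.failProb R I ρ k (encBatch I.n N b) c)
      ≤ ∑' b, p b * (∑ i ∈ Finset.range M, ENNReal.ofReal |C| * ENNReal.ofReal (f i b) +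
          ENNReal.ofReal |νR I.n|) := ENNReal.tsum_le_tsum fun b => mul_le_mul' le_rfl (hper b)
    _ = ∑' b, (∑ i ∈ Finset.range M, ENNReal.ofReal |C| * (p b * ENNReal.ofReal (f i b)) +
          p b * ENNReal.ofReal |νR I.n|) := by
        refine tsum_congr fun b => ?_
        rw [mul_add, Finset.mul_sum]
        refine congrArg (· + _) (Finset.sum_congr rfl fun i _ => ?_)
        ring
    _ = ∑ i ∈ Finset.range M, ENNReal.ofReal |C| * ∑' b, p b * ENNReal.ofReal (f i b) +
          (∑' b, p b) * ENNReal.ofReal |νR I.n| := by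
        rw [ENNReal.tsum_add, ENNReal.tsum_mul_right,
          Summable.tsum_finsetSum fun _ _ => ENNReal.summable]
        refine congrArg (· + _) (Finset.sum_congr rfl fun i _ => ?_)
        rw [ENNReal.tsum_mul_left]
    _ ≤ ∑ i ∈ Finset.range M, ENNReal.ofReal |C| * ENNReal.ofReal |νT I.n| + 1 * ENNReal.ofReal |νR I.n| := by
        rw [PMF.tsum_coe]
        exact add_le_add (Finset.sum_le_sum fun i _ => mul_le_mul' le_rfl (hround i)) le_rfl
    _ = ENNReal.ofReal (((pR.eval I.n : ℕ) : ℝ) * (|C| * |νT I.n|) + |νR I.n|) := by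
        rw [Finset.sum_const, Finset.card_range, nsmul_eq_mul, one_mul,
          ENNReal.ofReal_add (by positivity) (abs_nonneg _), ENNReal.ofReal_mul (Nat.cast_nonneg _),
          ENNReal.ofReal_natCast, ENNReal.ofReal_mul (abs_nonneg C)]

/-- **A_exact from A_cvpq, A_lift and A_q14** (via `regev2009_lemma_3_3_stepExact_of_cvp_of_step`).
[cite: Regev2009, Lemma 3.3 (proof, p. 15) = Lemma 3.4 (= Lemma 3.5 + Lemmas 3.7/3.11) + Lemma 3.14] -/
theorem regev2009_lemma_3_3_stepExact_of_cvpq_of_lift_of_step (hT : regev2009_lemma_3_11_cvpqFamily q α)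
    (hL : regev2009_lemma_3_5_liftFamily q) (hQ : regev2009_lemma_3_14_stepFamily q α) :
    regev2009_lemma_3_3_stepExact q α :=
  regev2009_lemma_3_3_stepExact_of_cvp_of_step q α (regev2009_lemma_3_4_cvpFamily_of_cvpq_of_lift q α hT hL) hQ

/-- **A_step from A_cvpq, A_lift and A_q14.** [cite: Regev2009, Lemma 3.3 (proof, p. 15), Lemmas 3.4, 3.5, 3.7, 3.11, 3.14] -/
theorem regev2009_lemma_3_3_stepMachine_of_cvpq_of_lift_of_step (hT : regev2009_lemma_3_11_cvpqFamily q α)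
    (hL : regev2009_lemma_3_5_liftFamily q) (hQ : regev2009_lemma_3_14_stepFamily q α) :
    regev2009_lemma_3_3_stepMachine q α :=
  regev2009_lemma_3_3_stepMachine_of_cvp_of_step q α (regev2009_lemma_3_4_cvpFamily_of_cvpq_of_lift q α hT hL) hQ

/-- **`pqc.S19` as filed — Regev's Theorem 1.1, `SIVP` form — from the three residuals A_cvpq (Lemmas
3.7/3.11, classical around the `LWE` oracle), A_lift (Lemma 3.5, classical) and A_q14 (Lemma 3.14, quantum)
alone**, every other step of Regev's §3 being proved in the tree. [cite: Regev2009, Theorem 1.1, Theorem 3.1, Lemma 3.3, Lemma 3.4 (= Lemma 3.5 + Lemmas 3.7/3.11), Lemma 3.14, Lemma 3.17] -/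
theorem regev_lwe_to_sivp_quantum_holds_of_cvpq_of_lift_of_step (m : ℕ → ℕ)
    (hT : regev2009_lemma_3_11_cvpqFamily q α) (hL : regev2009_lemma_3_5_liftFamily q)
    (hQ : regev2009_lemma_3_14_stepFamily q α) : regev_lwe_to_sivp_quantum q α m :=
  regev_lwe_to_sivp_quantum_holds_of_cvp_of_step q α m (regev2009_lemma_3_4_cvpFamily_of_cvpq_of_lift q α hT hL) hQ

/-- **Regev's Theorem 1.1, `GapSVP` form, from A_cvpq, A_lift and A_q14 alone.**
[cite: Regev2009, Theorem 1.1, Theorem 3.1, Lemma 3.3, Lemma 3.4 (= Lemma 3.5 + Lemmas 3.7/3.11), Lemma 3.14, Lemma 3.20] -/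
theorem regev_lwe_to_gapSVP_quantum_holds_of_cvpq_of_lift_of_step (m : ℕ → ℕ)
    (hT : regev2009_lemma_3_11_cvpqFamily q α) (hL : regev2009_lemma_3_5_liftFamily q)
    (hQ : regev2009_lemma_3_14_stepFamily q α) : regev_lwe_to_gapSVP_quantum q α m :=
  regev_lwe_to_gapSVP_quantum_holds_of_cvp_of_step q α m (regev2009_lemma_3_4_cvpFamily_of_cvpq_of_lift q α hT hL) hQ

end Split

end Literature.Computability.Cryptography

end
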